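import Summits.QuantumFields.BalabanUV.T4Continuum.Support.CovariantBlockAveragingPairing

/-!
# T⁴ programme, spine node NE2 (U1a), tier B row B3.b-conc (iii) — NORM LAWS of the two-level pairing of the transport error:
# `‖E_{k+1}(J_k ⊗ 1) − E_k‖ ≤ card o·(θ_k + τ·L^{−k})` and the `E`-datum `AveragingLaws … (Ecov L M R) …` of the Gram law

NE2 formalisation swarm `b2b-balaban-t4-ne2-formalise-*`, leaf prover 07; companion of `Support/CovariantBlockAveragingPairing` (the ENTRY
IDENTITY `pairing_apply` of `pairD = √(L^d)·(Q′(R′) − Q′ ⊗ 1)(J_L ⊗ 1) − (Q(R) − Q ⊗ 1)`).  §3: the ENTRY LAW `norm_pairing_apply_le`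
from the two-level consistency `θ` of the contour transporters — HYPOTHESIS SHAPE (row B3.b-conc (ii), leaf-06)
`∀ y μ j r t′ < L·n, ‖T′_{y,L·j+r,μ,t′} − T_{y,j,μ,⌊(r_μ+t′)/L⌋}‖ ≤ θ` — and their size `‖T_{y,j,μ,s} − 1‖ ≤ τ` (`s ≤ n`; DISCHARGED from
the per-bond size by `norm_ctr_sub_one_le`, `τ = e^{(d+1)α} − 1`); ROW SUMS `pairing_row_le : ≤ card o·(θ + τ/n)` (each fine triple lands
on one coarse point), COLUMN SUMS `pairing_col_le : ≤ card o·(θ + τ/n)·n^{−d}` (the blocks tile the torus), the rectangular Schur test ⟹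
**`opNorm_pairing_le : ‖√((Ln)^d)·(Q′(R′) − Q′⊗1)(J_L ⊗ 1) − √(n^d)·(Q(R) − Q⊗1)‖ ≤ card o·(θ + τ/n)`**.  §4 along the tower
(`idx L M (k+1) = Tor (fine (L·n_k) M) × Fin d`, `JpcT k = JK n_k L M` definitionally): **`opNorm_Ecov_succ_mul_J_sub_le`**
`‖Ecov R (k+1) * (JpcT k ⊗ₖ 1) − Ecov R k‖ ≤ card o·(θ k + τ/L^k)`; with `‖(Δ_a^{(k)} ⊗ 1)⁻¹‖ ≤ Cst` ((1.89) order zero) the SANDWICHED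
pairings: **`averagingLaws_Ecov : AveragingLaws (k ↦ calDalev k ⊗ₖ 1) (Ecov L M R) (k ↦ JpcT k ⊗ₖ 1) (card o·(e^{(d+1)α} − 1))
(k ↦ Cst·card o·(θ k + τ/L^k))`** (`GramPerturbationLaw.AveragingLaws` — the `hE` input of the Gram law for leaf-01's B3.b-inst), the
GEOMETRIC form `averagingLaws_Ecov_geom` (`θ k ≤ θ₀·L^{−k}` ⟹ pairing sequence `Cst·card o·(θ₀ + τ)·L^{−k}`) and
**`averagingLaws_Ecov_of_bond`** (per-bond size + geometric transporter consistency ONLY).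

HONEST FRAMING (T4-DAG p. 1).  Bookkeeping (Schur bounds) about the TYPED operators of the companion files; the transporters are DATA;
their two-level consistency `θ` is a HYPOTHESIS (row B3.b-conc (ii) — for Bałaban's backgrounds NE3's `LocalRate` content by name, c2;
asserted by nobody here); no B0; constants OURS and symbolic; finite torus, linear layer, operator norm; NOT NE2, NOT [B9] (3.23)–(3.26)
as printed, NOT infinite volume / mass gap / Clay; spine 0/9 unchanged.  HONEST DEPENDENCY: continuum YM on T⁴ ⇐ BetaPertH ∧ nine spine
estimates (0/9 proved); BetaPertH ⇐ (D1) ∧ (D4) ∧ CAP+tail; G-an2-4 gates asym, D1 and NE2/3/4.  ABSOLUTE RULE kept; no `sorry`.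
-/

noncomputable section

open scoped BigOperators ComplexConjugate Matrix Matrix.Norms.L2Operator Kronecker
open Finset
namespace Summit.QuantumFields.BalabanUV.T4Continuum.CovariantBlockAveraging

open Literature.MathematicalPhysics.QuantumFieldTheory.Balaban1983to89.B5Prop11Plancherel (Tor fine unitVec Cst Cst_nonneg)
open Literature.MathematicalPhysics.QuantumFieldTheory.Balaban1983to89.B5Block118 (QvOp bpt tstep tstep_zero)
open Literature.MathematicalPhysics.QuantumFieldTheory.Balaban1983to89.B5G183RateUnitTower (lev lev_neZero)
open Literature.MathematicalPhysics.QuantumFieldTheory.Balaban1983to89.Beta.DeltaACombesThomas (sum_blocks_ite)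
open Summit.QuantumFields.BalabanUV.T4Continuum.BalabanAveragedTowerUnit (idx norm_entry_le_opNorm one_le_lev' cast_lev')
open Summit.QuantumFields.BalabanUV.T4Continuum.BalabanAveragedTowerModes (par)
open Summit.QuantumFields.BalabanUV.T4Continuum.KingPairingPlantedLaw (JK JpcT calDalev calDalev_inv opNorm_inv_calDalev_le sqrt_facts)
open Summit.QuantumFields.BalabanUV.T4Continuum.BlockPairingGeometry (parT JK_apply)
open Summit.QuantumFields.BalabanUV.T4Continuum.LineAveragingPairing (glue sum_glue par_bpt_glue_add_tstep tent_count sum_fun_coord cL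
  norm_cL_le)
open Summit.QuantumFields.BalabanUV.T4Continuum.GramPerturbationLaw (AveragingLaws)
open Summit.QuantumFields.BalabanUV.T4Continuum.KroneckerLift

variable {d : ℕ}
/-! ## §3 Norm bounds: the entry law, Schur, and the tower -/

section TwoLevel

variable (n L : ℕ) [NeZero n] [NeZero L] (M : Fin d → ℕ) [hM : ∀ μ, NeZero (M μ)] {o : Type*} [Fintype o] [DecidableEq o]

/-- **ENTRY LAW**: with the two-level consistency `θ` of the contour transporters and their size `τ`,
`|pairing entry| ≤ n^{−(d+1)}·(L^{−(d+1)}·θ·N + (τ/2)·(G_n + G_0))`, `N`, `G_s` the indicator counts. [folklore] -/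
theorem norm_pairing_apply_le {R' : Fin d → (Tor (fine (L * n) M) × Fin d → Matrix o o ℂ)}
    {R : Fin d → (Tor (fine n M) × Fin d → Matrix o o ℂ)} {θ τ : ℝ}
    (hT2 : ∀ (y : Tor M) (μ : Fin d) (j : Fin d → Fin n) (r : Fin d → Fin L) (t' : ℕ), t' < L * n →
      ‖ctr M (L * n) R' y (glue n L (j, r)) μ t' - ctr M n R y j μ (((r μ : ℕ) + t') / L)‖ ≤ θ)
    (hTτ : ∀ (y : Tor M) (μ : Fin d) (j : Fin d → Fin n) (s : ℕ), s ≤ n → ‖ctr M n R y j μ s - 1‖ ≤ τ)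
    (b : (Tor M × Fin d) × o) (i : Tor (fine n M) × Fin d) (α' : o) :
    ‖pairD n L M R' R b (i, α')‖
      ≤ if i.2 = b.1.2 then
          (1 / (n : ℝ) ^ (d + 1)) *
            ((1 / (L : ℝ) ^ (d + 1)) * θ *
                ∑ j : Fin d → Fin n, ∑ r : Fin d → Fin L, ∑ t' : Fin (L * n),
                  (if bpt n M b.1.1 j + tstep (fine n M) b.1.2 (((r b.1.2 : ℕ) + t') / L) = i.1 then (1 : ℝ) else 0)
              + (τ / 2) * (∑ j : Fin d → Fin n, (if bpt n M b.1.1 j + tstep (fine n M) b.1.2 n = i.1 then (1 : ℝ) else 0)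
                  + ∑ j : Fin d → Fin n, (if bpt n M b.1.1 j + tstep (fine n M) b.1.2 0 = i.1 then (1 : ℝ) else 0)))
        else 0 := by
  have hL : 0 < L := Nat.pos_of_ne_zero (NeZero.ne L)
  rw [pairing_apply]
  by_cases h : i.2 = b.1.2
  · rw [if_pos h, if_pos h, norm_mul, norm_div, norm_one, norm_pow, Complex.norm_natCast]
    refine mul_le_mul_of_nonneg_left ?_ (by positivity)
    refine (norm_add_le _ _).trans (add_le_add ?_ ?_)
    · rw [norm_mul, norm_div, norm_one, norm_pow, Complex.norm_natCast, mul_assoc, Finset.mul_sum]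
      refine mul_le_mul_of_nonneg_left ?_ (by positivity)
      refine (norm_sum_le _ _).trans (Finset.sum_le_sum fun j _ => ?_)
      rw [Finset.mul_sum]
      refine (norm_sum_le _ _).trans (Finset.sum_le_sum fun r _ => ?_)
      rw [Finset.mul_sum]
      refine (norm_sum_le _ _).trans (Finset.sum_le_sum fun t' _ => ?_)
      split_ifs
      · rw [mul_one]
        exact (norm_entry_le_opNorm _ _ _).trans (hT2 _ _ _ _ _ t'.isLt)
      · simp
    · rw [norm_mul]
      have hA : ∀ j : Fin d → Fin n,
          ‖(if bpt n M b.1.1 j + tstep (fine n M) b.1.2 n = i.1 then (ctr M n R b.1.1 j b.1.2 n - 1) b.2 α' else 0)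
              - (if bpt n M b.1.1 j + tstep (fine n M) b.1.2 0 = i.1 then (ctr M n R b.1.1 j b.1.2 0 - 1) b.2 α' else 0)‖
            ≤ τ * (if bpt n M b.1.1 j + tstep (fine n M) b.1.2 n = i.1 then (1 : ℝ) else 0)
              + τ * (if bpt n M b.1.1 j + tstep (fine n M) b.1.2 0 = i.1 then (1 : ℝ) else 0) := by
        intro j
        refine (norm_sub_le _ _).trans (add_le_add ?_ ?_)
        · split_ifs
          · rw [mul_one]; exact (norm_entry_le_opNorm _ _ _).trans (hTτ _ _ _ _ le_rfl)
          · simp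
        · split_ifs
          · rw [mul_one]; exact (norm_entry_le_opNorm _ _ _).trans (hTτ _ _ _ _ (Nat.zero_le _))
          · simp
      calc _ ≤ (1 / 2) * ∑ j : Fin d → Fin n,
              (τ * (if bpt n M b.1.1 j + tstep (fine n M) b.1.2 n = i.1 then (1 : ℝ) else 0)
                + τ * (if bpt n M b.1.1 j + tstep (fine n M) b.1.2 0 = i.1 then (1 : ℝ) else 0)) :=
            mul_le_mul (norm_cL_le L hL) ((norm_sum_le _ _).trans (Finset.sum_le_sum fun j _ => hA j)) (norm_nonneg _)
              (by norm_num)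
        _ = _ := by rw [Finset.sum_add_distrib, ← Finset.mul_sum, ← Finset.mul_sum]; ring
  · rw [if_neg h, if_neg h, norm_zero]


/-- the block partition, indicator written as `n·y + j + s = x`. [folklore] -/
theorem sum_blocks_ite' (x s : Tor (fine n M)) (c : ℝ) :
    ∑ y : Tor M, ∑ j : Fin d → Fin n, (if bpt n M y j + s = x then c else 0) = c := by
  have h := sum_blocks_ite n M x s c
  simp_rw [eq_comm (a := x)] at h
  exact h

/-- **ROW SUMS** of the two-level pairing matrix: `≤ card o·(θ + τ/n)`. [folklore] -/
theorem pairing_row_le {R' : Fin d → (Tor (fine (L * n) M) × Fin d → Matrix o o ℂ)}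
    {R : Fin d → (Tor (fine n M) × Fin d → Matrix o o ℂ)} {θ τ : ℝ}
    (hT2 : ∀ (y : Tor M) (μ : Fin d) (j : Fin d → Fin n) (r : Fin d → Fin L) (t' : ℕ), t' < L * n →
      ‖ctr M (L * n) R' y (glue n L (j, r)) μ t' - ctr M n R y j μ (((r μ : ℕ) + t') / L)‖ ≤ θ)
    (hTτ : ∀ (y : Tor M) (μ : Fin d) (j : Fin d → Fin n) (s : ℕ), s ≤ n → ‖ctr M n R y j μ s - 1‖ ≤ τ)
    (b : (Tor M × Fin d) × o) :
    ∑ c : (Tor (fine n M) × Fin d) × o, ‖pairD n L M R' R b c‖ ≤ Fintype.card o * (θ + τ / n) := by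
  have hn : (n : ℝ) ≠ 0 := by exact_mod_cast NeZero.ne n
  have hLr : (L : ℝ) ≠ 0 := by exact_mod_cast NeZero.ne L
  have hN : ∑ x : Tor (fine n M), ∑ j : Fin d → Fin n, ∑ r : Fin d → Fin L, ∑ t' : Fin (L * n),
      (if bpt n M b.1.1 j + tstep (fine n M) b.1.2 (((r b.1.2 : ℕ) + t') / L) = x then (1 : ℝ) else 0)
      = (n : ℝ) ^ d * ((L : ℝ) ^ d * (L * n)) := by
    rw [Finset.sum_comm]
    have e : ∀ j : Fin d → Fin n, ∑ x : Tor (fine n M), ∑ r : Fin d → Fin L, ∑ t' : Fin (L * n),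
        (if bpt n M b.1.1 j + tstep (fine n M) b.1.2 (((r b.1.2 : ℕ) + t') / L) = x then (1 : ℝ) else 0) = (L : ℝ) ^ d * (L * n) := by
      intro j
      rw [Finset.sum_comm]
      have e2 : ∀ r : Fin d → Fin L, ∑ x : Tor (fine n M), ∑ t' : Fin (L * n),
          (if bpt n M b.1.1 j + tstep (fine n M) b.1.2 (((r b.1.2 : ℕ) + t') / L) = x then (1 : ℝ) else 0) = L * n := by
        intro r
        rw [Finset.sum_comm]
        simp only [Finset.sum_ite_eq, Finset.mem_univ, if_true, Finset.sum_const, Finset.card_univ, Fintype.card_fin, nsmul_eq_mul,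
          mul_one]
        push_cast; ring
      rw [Finset.sum_congr rfl fun r _ => e2 r, Finset.sum_const, Finset.card_univ]
      simp only [Fintype.card_fun, Fintype.card_fin, nsmul_eq_mul]
      push_cast; ring
    rw [Finset.sum_congr rfl fun j _ => e j, Finset.sum_const, Finset.card_univ]
    simp only [Fintype.card_fun, Fintype.card_fin, nsmul_eq_mul]
    push_cast; ring
  have hG : ∀ s : ℕ, ∑ x : Tor (fine n M), ∑ j : Fin d → Fin n, (if bpt n M b.1.1 j + tstep (fine n M) b.1.2 s = x then (1 : ℝ) else 0)
      = (n : ℝ) ^ d := by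
    intro s
    rw [Finset.sum_comm]
    simp only [Finset.sum_ite_eq, Finset.mem_univ, if_true, Finset.sum_const, Finset.card_univ, Fintype.card_fun, Fintype.card_fin,
      nsmul_eq_mul, mul_one]
    push_cast; ring
  rw [Fintype.sum_prod_type]
  calc ∑ i : Tor (fine n M) × Fin d, ∑ α' : o, ‖pairD n L M R' R b (i, α')‖
      ≤ ∑ i : Tor (fine n M) × Fin d, ∑ _α' : o, (if i.2 = b.1.2 then
          (1 / (n : ℝ) ^ (d + 1)) *
            ((1 / (L : ℝ) ^ (d + 1)) * θ *
                ∑ j : Fin d → Fin n, ∑ r : Fin d → Fin L, ∑ t' : Fin (L * n),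
                  (if bpt n M b.1.1 j + tstep (fine n M) b.1.2 (((r b.1.2 : ℕ) + t') / L) = i.1 then (1 : ℝ) else 0)
              + (τ / 2) * (∑ j : Fin d → Fin n, (if bpt n M b.1.1 j + tstep (fine n M) b.1.2 n = i.1 then (1 : ℝ) else 0)
                  + ∑ j : Fin d → Fin n, (if bpt n M b.1.1 j + tstep (fine n M) b.1.2 0 = i.1 then (1 : ℝ) else 0)))
          else 0) :=
        Finset.sum_le_sum fun i _ => Finset.sum_le_sum fun α' _ => norm_pairing_apply_le n L M hT2 hTτ b i α'
    _ = Fintype.card o * (θ + τ / n) := by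
        simp only [Finset.sum_const, Finset.card_univ, nsmul_eq_mul]
        rw [← Finset.mul_sum, Fintype.sum_prod_type]
        simp only [Finset.sum_ite_eq', Finset.mem_univ, if_true]
        rw [← Finset.mul_sum, Finset.sum_add_distrib, ← Finset.mul_sum, ← Finset.mul_sum, Finset.sum_add_distrib, hN, hG, hG]
        field_simp
        ring

/-- **COLUMN SUMS** of the two-level pairing matrix: `≤ card o·(θ + τ/n)·n^{−d}`. [folklore] -/
theorem pairing_col_le {R' : Fin d → (Tor (fine (L * n) M) × Fin d → Matrix o o ℂ)}
    {R : Fin d → (Tor (fine n M) × Fin d → Matrix o o ℂ)} {θ τ : ℝ}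
    (hT2 : ∀ (y : Tor M) (μ : Fin d) (j : Fin d → Fin n) (r : Fin d → Fin L) (t' : ℕ), t' < L * n →
      ‖ctr M (L * n) R' y (glue n L (j, r)) μ t' - ctr M n R y j μ (((r μ : ℕ) + t') / L)‖ ≤ θ)
    (hTτ : ∀ (y : Tor M) (μ : Fin d) (j : Fin d → Fin n) (s : ℕ), s ≤ n → ‖ctr M n R y j μ s - 1‖ ≤ τ)
    (i : Tor (fine n M) × Fin d) (α' : o) :
    ∑ b : (Tor M × Fin d) × o, ‖pairD n L M R' R b (i, α')‖ ≤ Fintype.card o * (θ + τ / n) * (1 / (n : ℝ) ^ d) := by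
  have hn : (n : ℝ) ≠ 0 := by exact_mod_cast NeZero.ne n
  have hLr : (L : ℝ) ≠ 0 := by exact_mod_cast NeZero.ne L
  have hN : ∑ y : Tor M, ∑ j : Fin d → Fin n, ∑ r : Fin d → Fin L, ∑ t' : Fin (L * n),
      (if bpt n M y j + tstep (fine n M) i.2 (((r i.2 : ℕ) + t') / L) = i.1 then (1 : ℝ) else 0) = (L : ℝ) ^ d * (L * n) := by
    have e : ∀ y : Tor M, ∑ j : Fin d → Fin n, ∑ r : Fin d → Fin L, ∑ t' : Fin (L * n),
        (if bpt n M y j + tstep (fine n M) i.2 (((r i.2 : ℕ) + t') / L) = i.1 then (1 : ℝ) else 0)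
        = ∑ r : Fin d → Fin L, ∑ t' : Fin (L * n), ∑ j : Fin d → Fin n,
          (if bpt n M y j + tstep (fine n M) i.2 (((r i.2 : ℕ) + t') / L) = i.1 then (1 : ℝ) else 0) := by
      intro y
      rw [Finset.sum_comm]
      exact Finset.sum_congr rfl fun r _ => Finset.sum_comm
    rw [Finset.sum_congr rfl fun y _ => e y, Finset.sum_comm]
    have e2 : ∀ r : Fin d → Fin L, ∑ y : Tor M, ∑ t' : Fin (L * n), ∑ j : Fin d → Fin n,
        (if bpt n M y j + tstep (fine n M) i.2 (((r i.2 : ℕ) + t') / L) = i.1 then (1 : ℝ) else 0) = L * n := by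
      intro r
      rw [Finset.sum_comm]
      simp_rw [sum_blocks_ite']
      rw [Finset.sum_const, Finset.card_univ, Fintype.card_fin, nsmul_eq_mul, mul_one]
      push_cast; ring
    rw [Finset.sum_congr rfl fun r _ => e2 r, Finset.sum_const, Finset.card_univ]
    simp only [Fintype.card_fun, Fintype.card_fin, nsmul_eq_mul]
    push_cast; ring
  rw [Fintype.sum_prod_type]
  calc ∑ b1 : Tor M × Fin d, ∑ α : o, ‖pairD n L M R' R (b1, α) (i, α')‖
      ≤ ∑ b1 : Tor M × Fin d, ∑ _α : o, (if i.2 = b1.2 then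
          (1 / (n : ℝ) ^ (d + 1)) *
            ((1 / (L : ℝ) ^ (d + 1)) * θ *
                ∑ j : Fin d → Fin n, ∑ r : Fin d → Fin L, ∑ t' : Fin (L * n),
                  (if bpt n M b1.1 j + tstep (fine n M) b1.2 (((r b1.2 : ℕ) + t') / L) = i.1 then (1 : ℝ) else 0)
              + (τ / 2) * (∑ j : Fin d → Fin n, (if bpt n M b1.1 j + tstep (fine n M) b1.2 n = i.1 then (1 : ℝ) else 0)
                  + ∑ j : Fin d → Fin n, (if bpt n M b1.1 j + tstep (fine n M) b1.2 0 = i.1 then (1 : ℝ) else 0)))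
          else 0) :=
        Finset.sum_le_sum fun b1 _ => Finset.sum_le_sum fun α _ => norm_pairing_apply_le n L M hT2 hTτ (b1, α) i α'
    _ = Fintype.card o * (θ + τ / n) * (1 / (n : ℝ) ^ d) := by
        simp only [Finset.sum_const, Finset.card_univ, nsmul_eq_mul]
        rw [← Finset.mul_sum, Fintype.sum_prod_type]
        simp only [Finset.sum_ite_eq, Finset.mem_univ, if_true]
        rw [← Finset.mul_sum, Finset.sum_add_distrib, ← Finset.mul_sum, ← Finset.mul_sum, Finset.sum_add_distrib, hN,
          sum_blocks_ite', sum_blocks_ite']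
        field_simp
        ring

/-- **THE TWO-LEVEL PAIRING BOUND (Schur)**: `‖D‖ ≤ card o·(θ + τ/n)·(√(n^d))⁻¹`. [folklore] -/
theorem opNorm_pairD_le {R' : Fin d → (Tor (fine (L * n) M) × Fin d → Matrix o o ℂ)}
    {R : Fin d → (Tor (fine n M) × Fin d → Matrix o o ℂ)} {θ τ : ℝ} (hθ : 0 ≤ θ) (hτ : 0 ≤ τ)
    (hT2 : ∀ (y : Tor M) (μ : Fin d) (j : Fin d → Fin n) (r : Fin d → Fin L) (t' : ℕ), t' < L * n →
      ‖ctr M (L * n) R' y (glue n L (j, r)) μ t' - ctr M n R y j μ (((r μ : ℕ) + t') / L)‖ ≤ θ)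
    (hTτ : ∀ (y : Tor M) (μ : Fin d) (j : Fin d → Fin n) (s : ℕ), s ≤ n → ‖ctr M n R y j μ s - 1‖ ≤ τ) :
    ‖pairD n L M R' R‖ ≤ Fintype.card o * (θ + τ / n) * (Real.sqrt ((n : ℝ) ^ d))⁻¹ := by
  have hn : (0 : ℝ) < (n : ℝ) ^ d := pow_pos (by exact_mod_cast Nat.pos_of_ne_zero (NeZero.ne n)) d
  have hK : 0 ≤ (Fintype.card o : ℝ) * (θ + τ / n) := by positivity
  refine (opNorm_le_sqrt_of_schur (R := Fintype.card o * (θ + τ / n)) (C := Fintype.card o * (θ + τ / n) * (1 / (n : ℝ) ^ d)) _ hK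
    (by positivity) (pairing_row_le n L M hT2 hTτ) (fun c => by obtain ⟨i, α'⟩ := c; exact pairing_col_le n L M hT2 hTτ i α')).trans
    (le_of_eq ?_)
  rw [show (Fintype.card o : ℝ) * (θ + τ / n) * (Fintype.card o * (θ + τ / n) * (1 / (n : ℝ) ^ d))
      = (Fintype.card o * (θ + τ / n)) ^ 2 * ((n : ℝ) ^ d)⁻¹ by ring,
    Real.sqrt_mul (sq_nonneg _), Real.sqrt_sq hK, Real.sqrt_inv]

/-- **THE TWO-LEVEL PAIRING OF THE SCALED TRANSPORT ERRORS**: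
`‖√((Ln)^d)·(Q′(R′) − Q′ ⊗ 1)(J_L ⊗ 1) − √(n^d)·(Q(R) − Q ⊗ 1)‖ ≤ card o·(θ + τ/n)`. [folklore] -/
theorem opNorm_pairing_le {R' : Fin d → (Tor (fine (L * n) M) × Fin d → Matrix o o ℂ)}
    {R : Fin d → (Tor (fine n M) × Fin d → Matrix o o ℂ)} {θ τ : ℝ} (hθ : 0 ≤ θ) (hτ : 0 ≤ τ)
    (hT2 : ∀ (y : Tor M) (μ : Fin d) (j : Fin d → Fin n) (r : Fin d → Fin L) (t' : ℕ), t' < L * n →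
      ‖ctr M (L * n) R' y (glue n L (j, r)) μ t' - ctr M n R y j μ (((r μ : ℕ) + t') / L)‖ ≤ θ)
    (hTτ : ∀ (y : Tor M) (μ : Fin d) (j : Fin d → Fin n) (s : ℕ), s ≤ n → ‖ctr M n R y j μ s - 1‖ ≤ τ) :
    ‖(((Real.sqrt ((((L * n : ℕ)) : ℝ) ^ d)) : ℝ) : ℂ)
        • ((Qcov (L * n) M (contour (L * n) M) R' - QvOp (L * n) M ⊗ₖ (1 : Matrix o o ℂ)) * (JK n L M ⊗ₖ (1 : Matrix o o ℂ)))
      - (((Real.sqrt ((n : ℝ) ^ d)) : ℝ) : ℂ) • (Qcov n M (contour n M) R - QvOp n M ⊗ₖ (1 : Matrix o o ℂ))‖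
      ≤ Fintype.card o * (θ + τ / n) := by
  have hn0 : (0 : ℝ) ≤ (n : ℝ) ^ d := pow_nonneg (Nat.cast_nonneg _) d
  have hpos : 0 < Real.sqrt ((n : ℝ) ^ d) := Real.sqrt_pos.mpr (pow_pos (by exact_mod_cast Nat.pos_of_ne_zero (NeZero.ne n)) d)
  have hsq : Real.sqrt ((((L * n : ℕ)) : ℝ) ^ d) = Real.sqrt ((n : ℝ) ^ d) * Real.sqrt ((L : ℝ) ^ d) := by
    rw [← Real.sqrt_mul hn0]; congr 1; push_cast; ring
  have e : (((Real.sqrt ((((L * n : ℕ)) : ℝ) ^ d)) : ℝ) : ℂ)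
        • ((Qcov (L * n) M (contour (L * n) M) R' - QvOp (L * n) M ⊗ₖ (1 : Matrix o o ℂ)) * (JK n L M ⊗ₖ (1 : Matrix o o ℂ)))
      - (((Real.sqrt ((n : ℝ) ^ d)) : ℝ) : ℂ) • (Qcov n M (contour n M) R - QvOp n M ⊗ₖ (1 : Matrix o o ℂ))
      = (((Real.sqrt ((n : ℝ) ^ d)) : ℝ) : ℂ) • pairD n L M R' R := by
    conv_rhs => rw [pairD, smul_sub, smul_smul, ← Complex.ofReal_mul, ← hsq]
  rw [e, norm_smul, Complex.norm_real, Real.norm_of_nonneg hpos.le]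
  calc Real.sqrt ((n : ℝ) ^ d) * ‖pairD n L M R' R‖
      ≤ Real.sqrt ((n : ℝ) ^ d) * (Fintype.card o * (θ + τ / n) * (Real.sqrt ((n : ℝ) ^ d))⁻¹) :=
        mul_le_mul_of_nonneg_left (opNorm_pairD_le n L M hθ hτ hT2 hTτ) hpos.le
    _ = Fintype.card o * (θ + τ / n) := by field_simp

omit [NeZero n] hM in
/-- contours with up to `n` line steps (the overflow contour `s = n` included) have at most `(d+1)·n` bonds. [folklore] -/
theorem length_contour_le_of_le (y : Tor M) (j : Fin d → Fin n) (μ : Fin d) {t : ℕ} (ht : t ≤ n) :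
    (contour n M y j μ t).length ≤ (d + 1) * n := by
  rw [contour, List.length_append, List.length_flatMap, length_leg]
  have h1 : (List.map (fun ν : Fin d => (leg n M ν (corner n M y j (ν : ℕ)) (j ν : ℕ)).length) (List.finRange d)).sum ≤ d * n := by
    have h2 : ∀ x ∈ List.map (fun ν : Fin d => (leg n M ν (corner n M y j (ν : ℕ)) (j ν : ℕ)).length) (List.finRange d), x ≤ n := by
      intro x hx
      obtain ⟨ν, _, rfl⟩ := List.mem_map.mp hx
      rw [length_leg]; exact (j ν).is_lt.le
    have h3 := List.sum_le_card_nsmul _ n h2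
    rw [List.length_map, List.length_finRange, smul_eq_mul] at h3
    exact h3
  calc _ ≤ d * n + n := add_le_add h1 ht
    _ = (d + 1) * n := by ring

omit hM in
/-- **THE SIZE OF THE CONTOUR TRANSPORTERS** (the `τ` above) from the per-bond size: `‖T_{y,j,μ,s} − 1‖ ≤ e^{(d+1)α} − 1` for `s ≤ n`.
[folklore] -/
theorem norm_ctr_sub_one_le {R : Fin d → (Tor (fine n M) × Fin d → Matrix o o ℂ)} {α : ℝ} (hα : 0 ≤ α)
    (hR : ∀ ν i, ‖R ν i - 1‖ ≤ α / n) (y : Tor M) (j : Fin d → Fin n) (μ : Fin d) {s : ℕ} (hs : s ≤ n) :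
    ‖ctr M n R y j μ s - 1‖ ≤ Real.exp ((d + 1 : ℕ) * α) - 1 := by
  have hn : 0 < n := Nat.pos_of_ne_zero (NeZero.ne n)
  exact (norm_transport_sub_one_le (fine n M) (by positivity) hR μ (length_contour_le_of_le n M y j μ hs)).trans
    (pow_sub_one_le_exp hα (d + 1) n hn)

end TwoLevel
/-! ## §4 Along the tower: the `E`-datum of the Gram law -/

section Tower

variable (L : ℕ) [NeZero L] (M : Fin d → ℕ) [hM : ∀ μ, NeZero (M μ)] (a : ℝ) (ha : 0 < a) {o : Type*} [Fintype o] [DecidableEq o]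

/-- **THE SANDWICH-FREE TWO-LEVEL LAW OF `E_k`**: `‖E_{k+1}(J_k ⊗ 1) − E_k‖ ≤ card o·(θ_k + τ·L^{−k})` from the two-level consistency
`θ_k` of the contour transporters at levels `k+1`/`k` and their size `τ`. [folklore] -/
theorem opNorm_Ecov_succ_mul_J_sub_le {R : (k : ℕ) → Fin d → (idx L M k → Matrix o o ℂ)} {θ : ℕ → ℝ} {τ : ℝ}
    (hθ : ∀ k, 0 ≤ θ k) (hτ : 0 ≤ τ)
    (hT2 : ∀ (k : ℕ) (y : Tor M) (μ : Fin d) (j : Fin d → Fin (lev L k)) (r : Fin d → Fin L) (t' : ℕ), t' < L * lev L k →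
      ‖ctr M (L * lev L k) (R (k + 1)) y (glue (lev L k) L (j, r)) μ t' - ctr M (lev L k) (R k) y j μ (((r μ : ℕ) + t') / L)‖ ≤ θ k)
    (hTτ : ∀ (k : ℕ) (y : Tor M) (μ : Fin d) (j : Fin d → Fin (lev L k)) (s : ℕ), s ≤ lev L k →
      ‖ctr M (lev L k) (R k) y j μ s - 1‖ ≤ τ) (k : ℕ) :
    ‖Ecov L M R (k + 1) * (JpcT L M k ⊗ₖ (1 : Matrix o o ℂ)) - Ecov L M R k‖ ≤ Fintype.card o * (θ k + τ / (lev L k : ℕ)) := by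
  have h := opNorm_pairing_le (lev L k) L M (hθ k) hτ (hT2 k) (hTτ k)
  rw [Ecov, Ecov, Matrix.smul_mul]
  exact h

/-- **THE `E`-DATUM OF THE GRAM LAW**: size `ε = card o·(e^{(d+1)α} − 1)` (`opNorm_Ecov_le`) and the SANDWICHED two-level pairings
`‖(E_{k+1}(J_k ⊗ 1) − E_k)(Δ_a^{(k)} ⊗ 1)⁻¹‖, ‖(Δ_a^{(k)} ⊗ 1)⁻¹(E_{k+1}(J_k ⊗ 1) − E_k)ᴴ‖ ≤ Cst·card o·(θ_k + τ·L^{−k})` — i.e.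
`GramPerturbationLaw.AveragingLaws` for `Ecov`, from the per-bond size `α·L^{−k}`, the transporter consistency `θ_k` (row B3.b-conc (ii),
HYPOTHESIS) and the transporter size `τ`. [cite: Balaban1984PropagatorsI, Prop. 1.1 (1.89) p.33 (‖Δ_a⁻¹‖ ≤ Cst)] [folklore] -/
theorem averagingLaws_Ecov {R : (k : ℕ) → Fin d → (idx L M k → Matrix o o ℂ)} {α τ : ℝ} {θ : ℕ → ℝ} (hα : 0 ≤ α)
    (hR : ∀ k ν i, ‖R k ν i - 1‖ ≤ α / (lev L k : ℕ)) (hθ : ∀ k, 0 ≤ θ k) (hτ : 0 ≤ τ)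
    (hT2 : ∀ (k : ℕ) (y : Tor M) (μ : Fin d) (j : Fin d → Fin (lev L k)) (r : Fin d → Fin L) (t' : ℕ), t' < L * lev L k →
      ‖ctr M (L * lev L k) (R (k + 1)) y (glue (lev L k) L (j, r)) μ t' - ctr M (lev L k) (R k) y j μ (((r μ : ℕ) + t') / L)‖ ≤ θ k)
    (hTτ : ∀ (k : ℕ) (y : Tor M) (μ : Fin d) (j : Fin d → Fin (lev L k)) (s : ℕ), s ≤ lev L k →
      ‖ctr M (lev L k) (R k) y j μ s - 1‖ ≤ τ) :
    AveragingLaws (fun k => calDalev L M a ha k ⊗ₖ (1 : Matrix o o ℂ)) (Ecov L M R) (fun k => JpcT L M k ⊗ₖ (1 : Matrix o o ℂ))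
      (Fintype.card o * (Real.exp ((d + 1 : ℕ) * α) - 1)) (fun k => Cst d a * (Fintype.card o * (θ k + τ / (lev L k : ℕ)))) where
  opNorm_le := opNorm_Ecov_le L M hα hR
  pair_mul_inv_le := fun k => by
    have hG : ‖(calDalev L M a ha k ⊗ₖ (1 : Matrix o o ℂ))⁻¹‖ ≤ Cst d a := by
      rw [kron_inv]; exact (opNorm_kron_le o _).trans (opNorm_inv_calDalev_le L M a ha k)
    calc _ ≤ ‖Ecov L M R (k + 1) * (JpcT L M k ⊗ₖ (1 : Matrix o o ℂ)) - Ecov L M R k‖ * ‖(calDalev L M a ha k ⊗ₖ (1 : Matrix o o ℂ))⁻¹‖ :=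
          Matrix.l2_opNorm_mul _ _
      _ ≤ Fintype.card o * (θ k + τ / (lev L k : ℕ)) * Cst d a :=
          mul_le_mul (opNorm_Ecov_succ_mul_J_sub_le L M hθ hτ hT2 hTτ k) hG (norm_nonneg _)
            (mul_nonneg (Nat.cast_nonneg _) (add_nonneg (hθ k) (div_nonneg hτ (Nat.cast_nonneg _))))
      _ = _ := by ring
  inv_mul_pair_le := fun k => by
    have hG : ‖(calDalev L M a ha k ⊗ₖ (1 : Matrix o o ℂ))⁻¹‖ ≤ Cst d a := by
      rw [kron_inv]; exact (opNorm_kron_le o _).trans (opNorm_inv_calDalev_le L M a ha k)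
    -- the lifted free propagator is Hermitian (in the tree as `GaugeTermLayer.inv_kron_conjTranspose`, whose B4 import closure is not
    -- pulled in here)
    have hH : ((calDalev L M a ha k ⊗ₖ (1 : Matrix o o ℂ))⁻¹)ᴴ = (calDalev L M a ha k ⊗ₖ (1 : Matrix o o ℂ))⁻¹ := by
      rw [kron_inv, kron_conjTranspose, calDalev_inv]
      congr 1
      exact (Literature.MathematicalPhysics.QuantumFieldTheory.Balaban1983to89.B5Prop11Plancherel.calG_isHermitian (lev L k)
        (one_le_lev' L k) M a ha).eq
    rw [← Matrix.l2_opNorm_conjTranspose, Matrix.conjTranspose_mul, Matrix.conjTranspose_conjTranspose, hH]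
    calc _ ≤ ‖Ecov L M R (k + 1) * (JpcT L M k ⊗ₖ (1 : Matrix o o ℂ)) - Ecov L M R k‖ * ‖(calDalev L M a ha k ⊗ₖ (1 : Matrix o o ℂ))⁻¹‖ :=
          Matrix.l2_opNorm_mul _ _
      _ ≤ Fintype.card o * (θ k + τ / (lev L k : ℕ)) * Cst d a :=
          mul_le_mul (opNorm_Ecov_succ_mul_J_sub_le L M hθ hτ hT2 hTτ k) hG (norm_nonneg _)
            (mul_nonneg (Nat.cast_nonneg _) (add_nonneg (hθ k) (div_nonneg hτ (Nat.cast_nonneg _))))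
      _ = _ := by ring

/-- `AveragingLaws` are monotone in the pairing sequence. [folklore] -/
theorem averagingLaws_mono {ι : ℕ → Type*} [∀ k, Fintype (ι k)] [∀ k, DecidableEq (ι k)] {σ : Type*} [Fintype σ] [DecidableEq σ]
    {D : (k : ℕ) → Matrix (ι k) (ι k) ℂ} {X : (k : ℕ) → Matrix σ (ι k) ℂ} {J : (k : ℕ) → Matrix (ι (k + 1)) (ι k) ℂ} {x : ℝ}
    {g g' : ℕ → ℝ} (h : AveragingLaws D X J x g) (hg : ∀ k, g k ≤ g' k) : AveragingLaws D X J x g' where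
  opNorm_le := h.opNorm_le
  pair_mul_inv_le := fun k => (h.pair_mul_inv_le k).trans (hg k)
  inv_mul_pair_le := fun k => (h.inv_mul_pair_le k).trans (hg k)

/-- **GEOMETRIC FORM** (the shape consumed by `GramPerturbationLaw.perturbationLaws_gram_king`): if the transporter consistency is
geometric, `θ_k ≤ θ₀·L^{−k}`, then `AveragingLaws … (Ecov L M R) … ε (k ↦ Cδ·L^{−k})` with `Cδ = Cst·card o·(θ₀ + τ)`. [folklore] -/
theorem averagingLaws_Ecov_geom {R : (k : ℕ) → Fin d → (idx L M k → Matrix o o ℂ)} {α τ θ₀ : ℝ} {θ : ℕ → ℝ} (hα : 0 ≤ α)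
    (hR : ∀ k ν i, ‖R k ν i - 1‖ ≤ α / (lev L k : ℕ)) (hθ : ∀ k, 0 ≤ θ k) (hτ : 0 ≤ τ)
    (hθg : ∀ k, θ k ≤ θ₀ * ((L : ℝ)⁻¹) ^ k)
    (hT2 : ∀ (k : ℕ) (y : Tor M) (μ : Fin d) (j : Fin d → Fin (lev L k)) (r : Fin d → Fin L) (t' : ℕ), t' < L * lev L k →
      ‖ctr M (L * lev L k) (R (k + 1)) y (glue (lev L k) L (j, r)) μ t' - ctr M (lev L k) (R k) y j μ (((r μ : ℕ) + t') / L)‖ ≤ θ k)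
    (hTτ : ∀ (k : ℕ) (y : Tor M) (μ : Fin d) (j : Fin d → Fin (lev L k)) (s : ℕ), s ≤ lev L k →
      ‖ctr M (lev L k) (R k) y j μ s - 1‖ ≤ τ) :
    AveragingLaws (fun k => calDalev L M a ha k ⊗ₖ (1 : Matrix o o ℂ)) (Ecov L M R) (fun k => JpcT L M k ⊗ₖ (1 : Matrix o o ℂ))
      (Fintype.card o * (Real.exp ((d + 1 : ℕ) * α) - 1)) (fun k => (Cst d a * Fintype.card o * (θ₀ + τ)) * ((L : ℝ)⁻¹) ^ k) := by
  refine averagingLaws_mono (averagingLaws_Ecov L M a ha hα hR hθ hτ hT2 hTτ) fun k => ?_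
  have hlev : (τ / (lev L k : ℕ) : ℝ) = τ * ((L : ℝ)⁻¹) ^ k := by rw [cast_lev', inv_pow, div_eq_mul_inv]
  rw [hlev]
  have hC := Cst_nonneg d a
  have hLk : 0 ≤ ((L : ℝ)⁻¹) ^ k := by positivity
  calc Cst d a * (Fintype.card o * (θ k + τ * ((L : ℝ)⁻¹) ^ k))
      ≤ Cst d a * (Fintype.card o * (θ₀ * ((L : ℝ)⁻¹) ^ k + τ * ((L : ℝ)⁻¹) ^ k)) := by gcongr; exact hθg k
    _ = (Cst d a * Fintype.card o * (θ₀ + τ)) * ((L : ℝ)⁻¹) ^ k := by ring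

/-- **THE `E`-DATUM FROM PER-BOND SIZE AND TRANSPORTER CONSISTENCY ONLY**: `τ = e^{(d+1)α} − 1` discharged by `norm_ctr_sub_one_le`;
the remaining hypothesis is the GEOMETRIC two-level consistency `θ k ≤ θ₀·L^{−k}` of the contour transporters (row B3.b-conc (ii)).
[folklore] -/
theorem averagingLaws_Ecov_of_bond {R : (k : ℕ) → Fin d → (idx L M k → Matrix o o ℂ)} {α θ₀ : ℝ} {θ : ℕ → ℝ} (hα : 0 ≤ α)
    (hR : ∀ k ν i, ‖R k ν i - 1‖ ≤ α / (lev L k : ℕ)) (hθ : ∀ k, 0 ≤ θ k) (hθg : ∀ k, θ k ≤ θ₀ * ((L : ℝ)⁻¹) ^ k)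
    (hT2 : ∀ (k : ℕ) (y : Tor M) (μ : Fin d) (j : Fin d → Fin (lev L k)) (r : Fin d → Fin L) (t' : ℕ), t' < L * lev L k →
      ‖ctr M (L * lev L k) (R (k + 1)) y (glue (lev L k) L (j, r)) μ t' - ctr M (lev L k) (R k) y j μ (((r μ : ℕ) + t') / L)‖ ≤ θ k) :
    AveragingLaws (fun k => calDalev L M a ha k ⊗ₖ (1 : Matrix o o ℂ)) (Ecov L M R) (fun k => JpcT L M k ⊗ₖ (1 : Matrix o o ℂ))
      (Fintype.card o * (Real.exp ((d + 1 : ℕ) * α) - 1))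
      (fun k => (Cst d a * Fintype.card o * (θ₀ + (Real.exp ((d + 1 : ℕ) * α) - 1))) * ((L : ℝ)⁻¹) ^ k) :=
  averagingLaws_Ecov_geom L M a ha hα hR hθ (sub_nonneg.mpr (Real.one_le_exp (by positivity))) hθg hT2
    (fun k y μ j _s hs => by haveI := lev_neZero L k; exact norm_ctr_sub_one_le (lev L k) M hα (hR k) y j μ hs)

end Tower


end Summit.QuantumFields.BalabanUV.T4Continuum.CovariantBlockAveraging

end
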